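import Summits.AnomalousDissipation.AnomalousDissipation.Theses.TaylorCertificates
import Summits.AnomalousDissipation.AnomalousDissipation.Theorems.TaylorCertificatePair.Negative.Modes
import Literature.Analysis.FunctionSpaces.TorusFluidGlueProofs

/-!
# A one-parameter family of mean-zero quiet Euler points of a shear-modulated Kolmogorov force

Crux `TaylorCertificates.SmoothEulerCoerciveForce` (stmt-AnomalousDissipation-14097), negative side
(cdisprove seat `refuter-cdisprove-stmt-AnomalousDissipation-14097-0`).

Mechanism ("componentwise transversal fields", the trigonometric shadow of the 2½-D first-integral dodger of
the Kolmogorov force recorded in the crux workfile `Cruxes/SmoothEulerCoerciveForce/Disproof.lean` (F3)):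
for `V = (a(Y), b(Z), c(Y))` on `(ℝ/2πℤ)³` one has `div V = 0` and `(V·∇)V = (b a′, c b′, b c′)`; if `b`, `c` are
trigonometric of the same frequency then `(c b′, b c′) = ∇_{(Y,Z)}Π`, so `V` is a quiet Euler point of the
unidirectional force `b(Z) a′(Y) e₁`.  With `a = −sin 2Y/(2ε)`, `b = −ε sin Z`, `c = −cos Y` (`ε ≠ 0`):
`(V·∇)V = cos 2Y sin Z · e₁ + ε∇(sin Y cos Z)`.  On the unit torus (`Y = 2πx₂`, `Z = 2πx₃`) this reads:
for EVERY real `ε ≠ 0` the three-mode field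
`v_ε = Re(e_{(0,2,0)} • (i/(2ε),0,0)) + Re(e_{(0,0,1)} • (0,iε,0)) + Re(e_{(0,1,0)} • (0,0,−1))`
is a smooth, divergence-free, MEAN-ZERO quiet Euler point of the fixed force
`f = 2π cos 2Y sin Z · e₁ = Re(e_{(0,2,1)} • (−πi,0,0)) + Re(e_{(0,−2,1)} • (−πi,0,0))`.

Consequences recorded for the crux: (i) shear-modulated Kolmogorov forces `g(x₂) sin(2πk x₃) e₁`, `∫g = 0`,
are not witnesses (here `g = cos 2Y`; general trigonometric `g` by the same bookkeeping, smooth `g` on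
paper); (ii) the fibre of the Lamb map `v ↦ P[(v·∇)v]` over this `f` contains a non-compact curve of
mean-zero quiet points (`‖v_ε‖² = 1/(8ε²) + ε²/2 + 1/2`), i.e. quiet points are neither unique nor isolated —
the degeneracy behind the failure of implicit-function arguments on either side of the crux.
Proof template = `Negative/TwoBeltramiDodger.lean` (antisymmetry of the trilinear form, the landed pair formula
`Negative.inertial_modes`, transversality and conjugate symmetry of the test field's Fourier coefficients).
No definitions; no statement of the route is asserted positively.
-/

noncomputable section

open MeasureTheory UnitAddTorus Matrix
open scoped InnerProductSpace ComplexConjugate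

namespace Summit.AnomalousDissipation.AnomalousDissipation.Theorems.SmoothEulerCoerciveForce.Negative

open Literature.Analysis.FunctionSpaces
open Summit.AnomalousDissipation.AnomalousDissipation.Theorems.TaylorCertificatePair.Negative

/-- **Weak steady Euler identity for the family `v_ε`.** For every real `ε ≠ 0` and every smooth divergence-free
test field `w`: `∫ ⟪(v_ε·∇)v_ε − f, w⟫ = 0`, where `v_ε = ∑ₘ Re(e_{K m} • Zp m)` (modes `(0,2,0),(0,0,1),(0,1,0)`,
polarisations `(i/(2ε),0,0),(0,iε,0),(0,0,−1)`) and `f = ∑ₘ Re(e_{KF m} • y)` (modes `(0,±2,1)`, `y = (−πi,0,0)`). -/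
theorem shearModulated_quiet {ε : ℝ} (hε : ε ≠ 0) {K : Fin 3 → Fin 3 → ℤ} {KF : Fin 2 → Fin 3 → ℤ}
    {Zp : Fin 3 → EuclideanSpace ℂ (Fin 3)} {y : EuclideanSpace ℂ (Fin 3)}
    (hK : K = ![![0, 2, 0], ![0, 0, 1], ![0, 1, 0]])
    (hZp : Zp = ![WithLp.toLp 2 ![Complex.I / (2 * (ε : ℂ)), 0, 0], WithLp.toLp 2 ![0, Complex.I * (ε : ℂ), 0],
      WithLp.toLp 2 ![0, 0, -1]])
    (hKF : KF = ![![0, 2, 1], ![0, -2, 1]]) (hy : y = WithLp.toLp 2 ![-(Real.pi : ℂ) * Complex.I, 0, 0])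
    (w : UnitAddTorus (Fin 3) → EuclideanSpace ℝ (Fin 3)) (hws : Torus.IsSmooth w) (hwd : Torus.IsDivFree w) :
    ∫ x, ⟪Torus.convect (∑ mm, Torus.realTrigPoly {K mm} (fun _ => Zp mm))
        (∑ mm, Torus.realTrigPoly {K mm} (fun _ => Zp mm)) x -
        (∑ mm, Torus.realTrigPoly {KF mm} (fun _ => y)) x, w x⟫_ℝ = 0 := by
  have hεC : (ε : ℂ) ≠ 0 := Complex.ofReal_ne_zero.mpr hε
  have hZp' : ∀ m, ((fun j => ((K m) j : ℂ)) ⬝ᵥ (WithLp.ofLp (Zp m))) = 0 := by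
    intro m; fin_cases m <;> simp [hK, hZp, dotProduct, Fin.sum_univ_three]
  have hvs : Torus.IsSmooth (∑ mm, Torus.realTrigPoly {K mm} (fun _ => Zp mm)) := isSmooth_modes K Zp
  have hvd : Torus.IsDivFree (∑ mm, Torus.realTrigPoly {K mm} (fun _ => Zp mm)) := isDivFree_modes K Zp hZp'
  have hfs : Torus.IsSmooth (∑ mm, Torus.realTrigPoly {KF mm} (fun _ => y)) := isSmooth_modes KF (fun _ => y)
  have hwi : Integrable w volume := hws.integrable
  -- split the integrand
  have h1 : Integrable (fun x => ⟪Torus.convect (∑ mm, Torus.realTrigPoly {K mm} (fun _ => Zp mm))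
      (∑ mm, Torus.realTrigPoly {K mm} (fun _ => Zp mm)) x, w x⟫_ℝ) volume :=
    ((hvs.convect hvs).inner hws).integrable
  have h2 : Integrable (fun x => ⟪(∑ mm, Torus.realTrigPoly {KF mm} (fun _ => y)) x, w x⟫_ℝ) volume :=
    (hfs.inner hws).integrable
  simp_rw [inner_sub_left]
  rw [integral_sub h1 h2]
  -- move the derivative onto `w` and use the pair formula
  rw [Torus.integral_inner_convect_eq_neg hvs hvd hvs hws]
  have hcomm : ∫ x, ⟪(∑ mm, Torus.realTrigPoly {K mm} (fun _ => Zp mm)) x,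
        Torus.convect (∑ mm, Torus.realTrigPoly {K mm} (fun _ => Zp mm)) w x⟫_ℝ =
      ∫ x, ⟪Torus.fderiv w x ((∑ mm, Torus.realTrigPoly {K mm} (fun _ => Zp mm)) x),
        (∑ mm, Torus.realTrigPoly {K mm} (fun _ => Zp mm)) x⟫_ℝ :=
    integral_congr_ae (ae_of_all _ fun x => real_inner_comm _ _)
  rw [hcomm, inertial_modes hws]
  -- the force pairing
  have hf : ∫ x, ⟪(∑ mm, Torus.realTrigPoly {KF mm} (fun _ => y)) x, w x⟫_ℝ =
      ∑ m, (⟪y, mFourierCoeff (EuclideanSpace.complexify ∘ w) (KF m)⟫_ℂ).re := by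
    simp_rw [modes_apply, sum_inner]
    rw [integral_finsetSum _ fun m _ =>
      ((continuous_mode _ _).inner hws.continuous).integrable_unitAddTorus]
    exact Finset.sum_congr rfl fun m _ => integral_inner_mode_left hwi _ _
  rw [hf]
  -- frequency bookkeeping
  have e1 : K 1 + K 0 = KF 0 := by funext i; fin_cases i <;> simp [hK, hKF]
  have e2 : K 0 - K 1 = -KF 1 := by funext i; fin_cases i <;> simp [hK, hKF]
  have e3 : K 2 + K 1 = K 1 + K 2 := add_comm _ _
  have e4 : K 2 - K 1 = -(K 1 - K 2) := (neg_sub _ _).symm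
  have hcs1 : mFourierCoeff (EuclideanSpace.complexify ∘ w) (-KF 1) =
      EuclideanSpace.conjVec (mFourierCoeff (EuclideanSpace.complexify ∘ w) (KF 1)) :=
    Torus.isConjSymm_mFourierCoeff hwi (KF 1)
  have hcs2 : mFourierCoeff (EuclideanSpace.complexify ∘ w) (-(K 1 - K 2)) =
      EuclideanSpace.conjVec (mFourierCoeff (EuclideanSpace.complexify ∘ w) (K 1 - K 2)) :=
    Torus.isConjSymm_mFourierCoeff hwi (K 1 - K 2)
  have htA := hwd.sum_mul_mFourierCoeff_eq_zero hws (KF 0)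
  have htB := hwd.sum_mul_mFourierCoeff_eq_zero hws (KF 1)
  have htC := hwd.sum_mul_mFourierCoeff_eq_zero hws (K 1 + K 2)
  have htD := hwd.sum_mul_mFourierCoeff_eq_zero hws (K 1 - K 2)
  simp only [Fin.sum_univ_two, Fin.sum_univ_three]
  rw [e1, e2, e3, e4, hcs1, hcs2]
  set A := mFourierCoeff (EuclideanSpace.complexify ∘ w) (KF 0) with hA
  set B := mFourierCoeff (EuclideanSpace.complexify ∘ w) (KF 1) with hB
  set C := mFourierCoeff (EuclideanSpace.complexify ∘ w) (K 1 + K 2) with hC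
  set D := mFourierCoeff (EuclideanSpace.complexify ∘ w) (K 1 - K 2) with hD
  clear_value A B C D
  subst hK hZp hKF hy
  simp only [Fin.sum_univ_three, Matrix.cons_val_zero, Matrix.cons_val_one, Matrix.head_cons,
    Matrix.cons_val_two, Matrix.tail_cons, Pi.add_apply, Pi.sub_apply] at htA htB htC htD
  simp only [dotProduct, Fin.sum_univ_three, Pi.add_apply, Pi.sub_apply, Pi.neg_apply,
    Matrix.cons_val_zero, Matrix.cons_val_one, Matrix.head_cons, Matrix.cons_val_two, Matrix.tail_cons,
    PiLp.inner_apply, RCLike.inner_apply, EuclideanSpace.conjVec_apply]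
  simp only [Int.cast_add, Int.cast_sub, Int.cast_neg, Int.cast_zero, Int.cast_one, Int.cast_ofNat]
    at htA htB htC htD ⊢
  have hA2 : A 2 = -2 * A 1 := by linear_combination htA
  have hB2 : B 2 = 2 * B 1 := by linear_combination htB
  have hC2 : C 2 = -C 1 := by linear_combination htC
  have hD2 : D 2 = D 1 := by linear_combination htD
  simp only [hA2, hB2, hC2, hD2, map_neg, map_mul, Complex.conj_conj]
  simp [Complex.mul_re, Complex.mul_im, Complex.conj_re, Complex.conj_im, Complex.div_re, Complex.div_im]
  field_simp
  ring

/-- **The shear-modulated Kolmogorov force is not a witness, uniformly along a curve of quiet points.**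
`f = 2π cos(2·2πx₂) sin(2πx₃) e₁` (as a real mode sum) is smooth, divergence free and mean zero, and for EVERY
`ε ≠ 0` the `∀ v` clause of the crux fails at the smooth, divergence-free, mean-zero three-mode field `v_ε`. -/
theorem shearModulated_not_witness :
    Torus.IsSmooth (∑ mm, Torus.realTrigPoly {(![![0, 2, 1], ![0, -2, 1]] : Fin 2 → Fin 3 → ℤ) mm}
          (fun _ => (WithLp.toLp 2 ![-(Real.pi : ℂ) * Complex.I, 0, 0] : EuclideanSpace ℂ (Fin 3)))) ∧
    Torus.IsDivFree (∑ mm, Torus.realTrigPoly {(![![0, 2, 1], ![0, -2, 1]] : Fin 2 → Fin 3 → ℤ) mm}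
          (fun _ => (WithLp.toLp 2 ![-(Real.pi : ℂ) * Complex.I, 0, 0] : EuclideanSpace ℂ (Fin 3)))) ∧
    Torus.HasZeroMean (∑ mm, Torus.realTrigPoly {(![![0, 2, 1], ![0, -2, 1]] : Fin 2 → Fin 3 → ℤ) mm}
          (fun _ => (WithLp.toLp 2 ![-(Real.pi : ℂ) * Complex.I, 0, 0] : EuclideanSpace ℂ (Fin 3)))) ∧
    ∀ ε : ℝ, ε ≠ 0 →
      Torus.IsSmooth (∑ mm, Torus.realTrigPoly {(![![0, 2, 0], ![0, 0, 1], ![0, 1, 0]] : Fin 3 → Fin 3 → ℤ) mm}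
          (fun _ => (![WithLp.toLp 2 ![Complex.I / (2 * (ε : ℂ)), 0, 0], WithLp.toLp 2 ![0, Complex.I * (ε : ℂ), 0],
            WithLp.toLp 2 ![0, 0, -1]] : Fin 3 → EuclideanSpace ℂ (Fin 3)) mm)) ∧
      Torus.IsDivFree (∑ mm, Torus.realTrigPoly {(![![0, 2, 0], ![0, 0, 1], ![0, 1, 0]] : Fin 3 → Fin 3 → ℤ) mm}
          (fun _ => (![WithLp.toLp 2 ![Complex.I / (2 * (ε : ℂ)), 0, 0], WithLp.toLp 2 ![0, Complex.I * (ε : ℂ), 0],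
            WithLp.toLp 2 ![0, 0, -1]] : Fin 3 → EuclideanSpace ℂ (Fin 3)) mm)) ∧
      Torus.HasZeroMean (∑ mm, Torus.realTrigPoly {(![![0, 2, 0], ![0, 0, 1], ![0, 1, 0]] : Fin 3 → Fin 3 → ℤ) mm}
          (fun _ => (![WithLp.toLp 2 ![Complex.I / (2 * (ε : ℂ)), 0, 0], WithLp.toLp 2 ![0, Complex.I * (ε : ℂ), 0],
            WithLp.toLp 2 ![0, 0, -1]] : Fin 3 → EuclideanSpace ℂ (Fin 3)) mm)) ∧
      ∀ w : UnitAddTorus (Fin 3) → EuclideanSpace ℝ (Fin 3), Torus.IsSmooth w → Torus.IsDivFree w →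
        Torus.HasZeroMean w →
        ∫ x, ⟪Torus.convect
            (∑ mm, Torus.realTrigPoly {(![![0, 2, 0], ![0, 0, 1], ![0, 1, 0]] : Fin 3 → Fin 3 → ℤ) mm}
              (fun _ => (![WithLp.toLp 2 ![Complex.I / (2 * (ε : ℂ)), 0, 0],
                WithLp.toLp 2 ![0, Complex.I * (ε : ℂ), 0], WithLp.toLp 2 ![0, 0, -1]] :
                Fin 3 → EuclideanSpace ℂ (Fin 3)) mm))
            (∑ mm, Torus.realTrigPoly {(![![0, 2, 0], ![0, 0, 1], ![0, 1, 0]] : Fin 3 → Fin 3 → ℤ) mm}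
              (fun _ => (![WithLp.toLp 2 ![Complex.I / (2 * (ε : ℂ)), 0, 0],
                WithLp.toLp 2 ![0, Complex.I * (ε : ℂ), 0], WithLp.toLp 2 ![0, 0, -1]] :
                Fin 3 → EuclideanSpace ℂ (Fin 3)) mm)) x -
            (∑ mm, Torus.realTrigPoly {(![![0, 2, 1], ![0, -2, 1]] : Fin 2 → Fin 3 → ℤ) mm}
              (fun _ => (WithLp.toLp 2 ![-(Real.pi : ℂ) * Complex.I, 0, 0] : EuclideanSpace ℂ (Fin 3)))) x,
            w x⟫_ℝ = 0 := by
  have hKF0 : ∀ m, (![![0, 2, 1], ![0, -2, 1]] : Fin 2 → Fin 3 → ℤ) m ≠ 0 := by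
    intro m h
    fin_cases m
    · have := congrFun h 2; simp at this
    · have := congrFun h 2; simp at this
  have hy' : ∀ m, ((fun j => (((![![0, 2, 1], ![0, -2, 1]] : Fin 2 → Fin 3 → ℤ) m) j : ℂ)) ⬝ᵥ
      (WithLp.ofLp (WithLp.toLp 2 ![-(Real.pi : ℂ) * Complex.I, 0, 0] : EuclideanSpace ℂ (Fin 3)))) = 0 := by
    intro m; fin_cases m <;> simp [dotProduct, Fin.sum_univ_three]
  refine ⟨isSmooth_modes _ _, isDivFree_modes _ _ hy', hasZeroMean_modes _ _ hKF0, fun ε hε => ?_⟩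
  have hK0 : ∀ m, (![![0, 2, 0], ![0, 0, 1], ![0, 1, 0]] : Fin 3 → Fin 3 → ℤ) m ≠ 0 := by
    intro m h
    fin_cases m
    · have := congrFun h 1; simp at this
    · have := congrFun h 2; simp at this
    · have := congrFun h 1; simp at this
  have hZp' : ∀ m, ((fun j => (((![![0, 2, 0], ![0, 0, 1], ![0, 1, 0]] : Fin 3 → Fin 3 → ℤ) m) j : ℂ)) ⬝ᵥ
      (WithLp.ofLp ((![WithLp.toLp 2 ![Complex.I / (2 * (ε : ℂ)), 0, 0], WithLp.toLp 2 ![0, Complex.I * (ε : ℂ), 0],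
        WithLp.toLp 2 ![0, 0, -1]] : Fin 3 → EuclideanSpace ℂ (Fin 3)) m))) = 0 := by
    intro m; fin_cases m <;> simp [dotProduct, Fin.sum_univ_three]
  exact ⟨isSmooth_modes _ _, isDivFree_modes _ _ hZp', hasZeroMean_modes _ _ hK0,
    fun w hws hwd _ => shearModulated_quiet hε rfl rfl rfl rfl w hws hwd⟩

end Summit.AnomalousDissipation.AnomalousDissipation.Theorems.SmoothEulerCoerciveForce.Negative
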